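import Literature.Geometry.PolyhedralFans.StrictSupport
import Literature.Geometry.PolyhedralFans.RegularBasis
import Literature.Combinatorics.Optimization.HilbertBasis
import Literature.RingTheory.MvPolynomial.GradedMonoidVeronese
import HarnessLib

/-!
# The section monoid of a strictly convex support function on a fan — Kato 1994 (10.4), [KKMS] I §2

`Literature/Geometry/PolyhedralFans/SectionMonoid.lean`. For a fan `Δ` in `ℚⁿ` and cone-wise
linear data `m` (a strictly convex `Δ`-linear support function `h = min_ρ ⟨m ρ, ·⟩`,
`Fan.IsStrictSupport`, [KKMS] I §2 / Kato 1994 (9.8)–(10.4)), the **section monoid**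
`Γ = {(u, j) ∈ ℤⁿ × ℕ : ⟨u, v⟩ ≥ j·h(v) on |Δ|}` — the graded monoid whose `Proj` is the toric
modification defined by the subdivision `Δ`, and whose degree-`k` piece generates the monoid
ideal blown up in the un-normalised construction:

* `secMonoid`, `mem_secMonoid_iff_gens` — definition; membership is tested on cone generators;
* `secMonoid_fg` — **finitely generated** (Gordan's lemma, tree `ratPolyCone_fg`);
* `exists_veronese` — some Veronese degree `k`: `Γ_{jk} = Γ_k + ⋯ + Γ_k` (tree
  `AddMonoid.FG.exists_veronese_level`); `exists_piece_generators` — `Γ_k = s + Γ₀`, `s` finite.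

The tight cone and the chart monoids of the blow-up are in `SectionMonoidTight.lean`.

References: [KempfEtAl1973] Ch. I §2 Thm. 11; [Kato1994] K. Kato, Toric singularities,
Amer. J. Math. 116 (1994), (9.8), (10.3), (10.4).
-/

noncomputable section

namespace Literature.Geometry.PolyhedralFans

open PointedCone Literature.Combinatorics.Optimization.HilbertBasis

variable {n : ℕ} (Δ : Fan ℚ (Fin n → ℚ)) (m : PointedCone ℚ (Fin n → ℚ) → (Fin n → ℚ))

/-! ### The section monoid -/

/-- **The section monoid** `Γ = {(u, j) : ⟨u − j·m ρ, v⟩ ≥ 0 for all cones ρ of Δ and v ∈ ρ}`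
of the cone-wise linear data `m` (graded by `j`). [cite: Kato1994, (10.4)] -/
def secMonoid : AddSubmonoid ((Fin n → ℤ) × ℕ) where
  carrier := {x | ∀ ρ ∈ Δ.cones, ∀ v ∈ ρ, 0 ≤ (toRat x.1 - (x.2 : ℚ) • m ρ) ⬝ᵥ v}
  zero_mem' := by
    intro ρ _ v _
    simp [toRat_zero]
  add_mem' := by
    intro x y hx hy ρ hρ v hv
    have h1 := hx ρ hρ v hv
    have h2 := hy ρ hρ v hv
    have : (toRat (x + y).1 - ((x + y).2 : ℚ) • m ρ) =
        (toRat x.1 - (x.2 : ℚ) • m ρ) + (toRat y.1 - (y.2 : ℚ) • m ρ) := by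
      rw [Prod.fst_add, Prod.snd_add, toRat_add, Nat.cast_add, add_smul]; abel
    rw [this, add_dotProduct]
    exact add_nonneg h1 h2

/-- Membership in the section monoid. [cite: Kato1994, (10.4)] -/
theorem mem_secMonoid_iff {x : (Fin n → ℤ) × ℕ} :
    x ∈ secMonoid Δ m ↔ ∀ ρ ∈ Δ.cones, ∀ v ∈ ρ, 0 ≤ (toRat x.1 - (x.2 : ℚ) • m ρ) ⬝ᵥ v :=
  Iff.rfl

/-- Membership is tested on generators of the cones. [cite: Kato1994, (10.4)] -/
theorem mem_secMonoid_iff_gens (gens : PointedCone ℚ (Fin n → ℚ) → Finset (Fin n → ℚ))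
    (hgens : ∀ ρ ∈ Δ.cones, PointedCone.hull ℚ (gens ρ : Set (Fin n → ℚ)) = ρ)
    {x : (Fin n → ℤ) × ℕ} :
    x ∈ secMonoid Δ m ↔ ∀ ρ ∈ Δ.cones, ∀ s ∈ gens ρ, 0 ≤ (toRat x.1 - (x.2 : ℚ) • m ρ) ⬝ᵥ s := by
  rw [mem_secMonoid_iff]
  refine forall₂_congr fun ρ hρ => ?_
  rw [← forall_mem_hull_dotProduct_nonneg_iff, hgens ρ hρ]

/-- **The degree** `(u, j) ↦ j` on the section monoid. [cite: Kato1994, (10.4)] -/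
def secDeg : secMonoid Δ m →+ ℕ := (AddMonoidHom.snd (Fin n → ℤ) ℕ).comp (secMonoid Δ m).subtype

/-- The degree is the second coordinate. [cite: Kato1994, (10.4)] -/
@[simp] theorem secDeg_apply (x : secMonoid Δ m) : secDeg Δ m x = (x : (Fin n → ℤ) × ℕ).2 := rfl

/-! ### Finite generation (Gordan) -/

section Gordan

variable (gens : PointedCone ℚ (Fin n → ℚ) → Finset (Fin n → ℚ))
  (hgens : ∀ ρ ∈ Δ.cones, PointedCone.hull ℚ (gens ρ : Set (Fin n → ℚ)) = ρ)

/-- The finite index set of (cone, generator) pairs. [cite: Kato1994, (10.4)] -/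
abbrev GenIdx : Type := Σ ρ : Δ.finite.toFinset, (gens (ρ : PointedCone ℚ (Fin n → ℚ)))

/-- The constraint matrix on `ℤⁿ⁺¹ = ℤⁿ × ℤ`: one row `(s, −⟨m ρ, s⟩)` per pair `(ρ, s)`, and the
row `(0, 1)` (degree `≥ 0`). [cite: Kato1994, (10.4)] -/
def secMatrix : Matrix (Option (GenIdx Δ gens)) (Fin (n + 1)) ℚ := fun i =>
  match i with
  | none => Fin.snoc 0 1
  | some ⟨ρ, s⟩ => Fin.snoc (s : Fin n → ℚ) (-(m ρ ⬝ᵥ (s : Fin n → ℚ)))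

/-- Dot product with a `snoc`-row. [folklore] -/
private theorem snoc_dotProduct_snoc (a : Fin n → ℚ) (b : ℚ) (c : Fin n → ℚ) (d : ℚ) :
    (Fin.snoc a b : Fin (n + 1) → ℚ) ⬝ᵥ (Fin.snoc c d : Fin (n + 1) → ℚ) = a ⬝ᵥ c + b * d := by
  simp [dotProduct, Fin.sum_univ_castSucc]

/-- The integral points of the constraint cone, as a submonoid of `ℤⁿ⁺¹`.
[cite: Kato1994, (10.4)] -/
def secCone : AddSubmonoid (Fin (n + 1) → ℤ) :=
  ratPolyCone (Matrix.of fun (i : Fin (Fintype.card (Option (GenIdx Δ gens)))) =>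
    secMatrix Δ m gens ((Fintype.equivFin _).symm i))

/-- Membership in the constraint cone. [cite: Kato1994, (10.4)] -/
theorem mem_secCone_iff {x : Fin (n + 1) → ℤ} :
    x ∈ secCone Δ m gens ↔ ∀ i, 0 ≤ secMatrix Δ m gens i ⬝ᵥ toRat x := by
  rw [secCone, mem_ratPolyCone, Pi.le_def]
  constructor
  · intro h i
    have := h (Fintype.equivFin _ i)
    simpa [Matrix.mulVec, Matrix.of_apply] using this
  · intro h i
    simpa [Matrix.mulVec, Matrix.of_apply] using h _

/-- `toRat` of a `snoc`. [folklore] -/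
private theorem toRat_snoc (u : Fin n → ℤ) (j : ℤ) :
    toRat (Fin.snoc u j : Fin (n + 1) → ℤ) = Fin.snoc (toRat u) (j : ℚ) := by
  ext i
  refine Fin.lastCases ?_ (fun i => ?_) i
  · simp [toRat, Fin.snoc_last]
  · simp [toRat, Fin.snoc_castSucc]

/-- `toRat` as a `snoc` of its initial part and last entry. [folklore] -/
private theorem toRat_eq_snoc (x : Fin (n + 1) → ℤ) :
    toRat x = Fin.snoc (toRat (Fin.init x)) ((x (Fin.last n) : ℤ) : ℚ) := by
  conv_lhs => rw [← Fin.snoc_init_self x]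
  exact toRat_snoc _ _

/-- Elements of the constraint cone have non-negative degree. [cite: Kato1994, (10.4)] -/
theorem last_nonneg_of_mem_secCone {x : Fin (n + 1) → ℤ} (hx : x ∈ secCone Δ m gens) :
    0 ≤ x (Fin.last n) := by
  have h := (mem_secCone_iff Δ m gens).1 hx none
  simp only [secMatrix] at h
  rw [toRat_eq_snoc, snoc_dotProduct_snoc, zero_dotProduct, zero_add, one_mul] at h
  exact_mod_cast h

/-- From `ℤⁿ⁺¹` with non-negative last coordinate to `ℤⁿ × ℕ`. [folklore] -/
def splitLast : secCone Δ m gens →+ (Fin n → ℤ) × ℕ where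
  toFun x := (Fin.init (x : Fin (n + 1) → ℤ), ((x : Fin (n + 1) → ℤ) (Fin.last n)).toNat)
  map_zero' := by ext <;> simp [Fin.init]
  map_add' x y := by
    have hx := last_nonneg_of_mem_secCone Δ m gens x.2
    have hy := last_nonneg_of_mem_secCone Δ m gens y.2
    ext
    · simp [Fin.init]
    · simp only [AddSubmonoid.coe_add, Pi.add_apply, Prod.snd_add]
      exact Int.toNat_add hx hy

include hgens in
/-- **The section monoid is the image of the constraint cone.** [cite: Kato1994, (10.4)] -/
theorem secMonoid_eq_map : secMonoid Δ m = (⊤ : AddSubmonoid (secCone Δ m gens)).map (splitLast Δ m gens) := by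
  ext ⟨u, j⟩
  constructor
  · intro hx
    have hx' := (mem_secMonoid_iff_gens Δ m gens hgens).1 hx
    have hmem : (Fin.snoc u (j : ℤ) : Fin (n + 1) → ℤ) ∈ secCone Δ m gens := by
      rw [mem_secCone_iff]
      rintro (_ | ⟨⟨ρ, hρ⟩, s, hs⟩)
      · simp only [secMatrix]
        rw [toRat_snoc, snoc_dotProduct_snoc, zero_dotProduct, zero_add, one_mul]
        exact_mod_cast Nat.zero_le j
      · have h1 := hx' ρ (Δ.finite.mem_toFinset.1 hρ) s hs
        rw [sub_dotProduct, smul_dotProduct, smul_eq_mul] at h1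
        simp only [secMatrix]
        rw [toRat_snoc, snoc_dotProduct_snoc, dotProduct_comm s (toRat u)]
        push_cast
        linarith
    refine ⟨⟨_, hmem⟩, AddSubmonoid.mem_top _, ?_⟩
    ext <;> simp [splitLast, Fin.init_snoc, Fin.snoc_last]
  · rintro ⟨⟨x, hxc⟩, -, hxeq⟩
    simp only [splitLast, AddMonoidHom.coe_mk, ZeroHom.coe_mk, Prod.mk.injEq] at hxeq
    obtain ⟨rfl, rfl⟩ := hxeq
    rw [mem_secMonoid_iff_gens Δ m gens hgens]
    intro ρ hρ s hs
    have hρ' : ρ ∈ Δ.finite.toFinset := Δ.finite.mem_toFinset.2 hρ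
    have h1 := (mem_secCone_iff Δ m gens).1 hxc (some ⟨⟨ρ, hρ'⟩, s, hs⟩)
    have h0 : 0 ≤ x (Fin.last n) := last_nonneg_of_mem_secCone Δ m gens hxc
    simp only [secMatrix] at h1
    rw [toRat_eq_snoc, snoc_dotProduct_snoc] at h1
    rw [sub_dotProduct, smul_dotProduct, smul_eq_mul, dotProduct_comm (toRat _) s]
    have hj : ((x (Fin.last n)).toNat : ℚ) = ((x (Fin.last n) : ℤ) : ℚ) := by
      exact_mod_cast Int.toNat_of_nonneg h0
    simp only
    rw [hj]
    linarith

include hgens in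
/-- **Gordan: the section monoid is finitely generated.** [cite: Kato1994, (10.4)] -/
theorem secMonoid_fg_of_gens : (secMonoid Δ m).FG := by
  rw [secMonoid_eq_map Δ m gens hgens]
  have h1 : (secCone Δ m gens).FG := ratPolyCone_fg _
  haveI : AddMonoid.FG (secCone Δ m gens) := (AddMonoid.fg_iff_addSubmonoid_fg _).2 h1
  exact AddSubmonoid.FG.map (AddMonoid.fg_def.1 this) (splitLast Δ m gens)

end Gordan

/-- **Gordan: the section monoid of cone-wise linear data on a fan is finitely generated.**
[cite: Kato1994, (10.4)] -/
theorem secMonoid_fg : (secMonoid Δ m).FG := by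
  classical
  let gens : PointedCone ℚ (Fin n → ℚ) → Finset (Fin n → ℚ) := fun ρ =>
    if h : ρ ∈ Δ.cones then (Δ.fg h).choose else ∅
  have hgens : ∀ ρ ∈ Δ.cones, PointedCone.hull ℚ (gens ρ : Set (Fin n → ℚ)) = ρ := by
    intro ρ hρ
    simp only [gens, dif_pos hρ]
    exact (Δ.fg hρ).choose_spec
  exact secMonoid_fg_of_gens Δ m gens hgens

/-! ### The graded pieces, the Veronese degree, generators -/

/-- **The degree-`j` piece** `Γ_j ⊆ ℤⁿ`. [cite: Kato1994, (10.4)] -/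
def piece (j : ℕ) : Set (Fin n → ℤ) := {u | (u, j) ∈ secMonoid Δ m}

/-- Membership in a piece. [cite: Kato1994, (10.4)] -/
theorem mem_piece_iff {j : ℕ} {u : Fin n → ℤ} : u ∈ piece Δ m j ↔ (u, j) ∈ secMonoid Δ m := Iff.rfl

/-- `Γ₀` is a submonoid (the dual monoid of the support). [cite: Kato1994, (10.4)] -/
def pieceZero : AddSubmonoid (Fin n → ℤ) where
  carrier := piece Δ m 0
  zero_mem' := by
    change ((0 : Fin n → ℤ), (0 : ℕ)) ∈ secMonoid Δ m
    rw [← Prod.zero_eq_mk]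
    exact (secMonoid Δ m).zero_mem
  add_mem' {a b} ha hb := by
    change (a + b, (0 : ℕ)) ∈ secMonoid Δ m
    have := (secMonoid Δ m).add_mem ha hb
    rwa [Prod.mk_add_mk, add_zero] at this

/-- Membership in `Γ₀`: `⟨u, v⟩ ≥ 0` on all cones. [cite: Kato1994, (10.4)] -/
theorem mem_pieceZero_iff {u : Fin n → ℤ} :
    u ∈ pieceZero Δ m ↔ ∀ ρ ∈ Δ.cones, ∀ v ∈ ρ, 0 ≤ toRat u ⬝ᵥ v := by
  show (u, 0) ∈ secMonoid Δ m ↔ _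
  rw [mem_secMonoid_iff]
  simp

/-- Pieces add. [cite: Kato1994, (10.4)] -/
theorem add_mem_piece {i j : ℕ} {u v : Fin n → ℤ} (hu : u ∈ piece Δ m i) (hv : v ∈ piece Δ m j) :
    u + v ∈ piece Δ m (i + j) := by
  change (u + v, i + j) ∈ secMonoid Δ m
  have := (secMonoid Δ m).add_mem hu hv
  rwa [Prod.mk_add_mk] at this

/-- **Veronese degree**: there is `k ≥ 1` such that every element of `Γ_{jk}` is a sum of `j`
elements of `Γ_k` (`j ≥ 1`). [cite: Kato1994, (10.4)] -/
theorem exists_veronese : ∃ k : ℕ, 0 < k ∧ ∀ j : ℕ, 0 < j → ∀ u ∈ piece Δ m (j * k),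
    ∃ us : Fin j → Fin n → ℤ, (∀ i, us i ∈ piece Δ m k) ∧ u = ∑ i, us i := by
  haveI : AddMonoid.FG (secMonoid Δ m) := (AddMonoid.fg_iff_addSubmonoid_fg _).2 (secMonoid_fg Δ m)
  obtain ⟨k, hk, hver⟩ := Literature.RingTheory.MvPolynomial.AddMonoid.FG.exists_veronese_level
    (secDeg Δ m)
  refine ⟨k, hk, fun j hj u hu => ?_⟩
  obtain ⟨xs, hdeg, hsum⟩ := hver j hj ⟨(u, j * k), hu⟩ (by simp)
  refine ⟨fun i => ((xs i : secMonoid Δ m) : (Fin n → ℤ) × ℕ).1, fun i => ?_, ?_⟩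
  · have h1 := hdeg i
    rw [secDeg_apply] at h1
    have h2 := (xs i).2
    rw [show ((xs i : secMonoid Δ m) : (Fin n → ℤ) × ℕ) =
      (((xs i : secMonoid Δ m) : (Fin n → ℤ) × ℕ).1, k) from Prod.ext rfl h1] at h2
    exact h2
  · have := congrArg (fun y : secMonoid Δ m => ((y : (Fin n → ℤ) × ℕ)).1) hsum
    simpa [AddSubmonoid.coe_finsetSum, Prod.fst_sum] using this

/-- **Finite generation of a piece over `Γ₀`**: `Γ_k = s + Γ₀` for a finite `s ⊆ Γ_k`.
[cite: Kato1994, (10.4)] -/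
theorem exists_piece_generators (k : ℕ) : ∃ s : Finset (Fin n → ℤ), (↑s ⊆ piece Δ m k) ∧
    ∀ u ∈ piece Δ m k, ∃ y ∈ s, ∃ z ∈ pieceZero Δ m, u = y + z := by
  classical
  obtain ⟨S, hS⟩ := secMonoid_fg Δ m
  -- generators of positive degree
  set Sp := S.filter fun g => 0 < g.2 with hSp
  -- candidate `y`'s: combinations of positive-degree generators with coefficients ≤ k, of degree k
  let cand : (↥Sp → Fin (k + 1)) → (Fin n → ℤ) × ℕ := fun c => ∑ g : ↥Sp, (c g : ℕ) • (g : (Fin n → ℤ) × ℕ)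
  let s : Finset (Fin n → ℤ) :=
    (Finset.univ.filter fun c : ↥Sp → Fin (k + 1) => (cand c).2 = k).image fun c => (cand c).1
  have hSsub : ∀ g ∈ S, g ∈ secMonoid Δ m := fun g hg => by
    rw [← hS]; exact AddSubmonoid.subset_closure hg
  have hcand_mem : ∀ c, cand c ∈ secMonoid Δ m := fun c =>
    AddSubmonoid.sum_mem _ fun g _ => AddSubmonoid.nsmul_mem _ (hSsub _ (Finset.mem_filter.1 g.2).1) _
  refine ⟨s, ?_, ?_⟩
  · intro y hy
    obtain ⟨c, hc, rfl⟩ := Finset.mem_image.1 hy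
    have hk : (cand c).2 = k := (Finset.mem_filter.1 hc).2
    show ((cand c).1, k) ∈ secMonoid Δ m
    rw [← hk]
    exact hcand_mem c
  · intro u hu
    have huS : (u, k) ∈ AddSubmonoid.closure (S : Set ((Fin n → ℤ) × ℕ)) := by rw [hS]; exact hu
    obtain ⟨f, -, hf⟩ := AddSubmonoid.mem_closure_finset.1 huS
    -- split the sum into positive-degree and degree-zero generators
    have hsplit : ∑ g ∈ S, f g • g = ∑ g ∈ Sp, f g • g + ∑ g ∈ S.filter (fun g => ¬ 0 < g.2), f g • g := by
      rw [hSp, Finset.sum_filter_add_sum_filter_not]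
    -- degrees: coefficients on `Sp` are ≤ k
    have hdeg : ∑ g ∈ Sp, f g * g.2 = k := by
      have h2 := congrArg Prod.snd hf
      rw [hsplit, Prod.snd_add, Prod.snd_sum, Prod.snd_sum] at h2
      have h3 : ∑ g ∈ S.filter (fun g => ¬ 0 < g.2), (f g • g).2 = 0 :=
        Finset.sum_eq_zero fun g hg => by
          have : g.2 = 0 := by have := (Finset.mem_filter.1 hg).2; omega
          simp [this]
      rw [h3, add_zero] at h2
      simpa using h2
    have hbound : ∀ g ∈ Sp, f g ≤ k := by
      intro g hg
      have hgpos : 0 < g.2 := (Finset.mem_filter.1 hg).2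
      have h1 : f g * g.2 ≤ k := by
        rw [← hdeg]
        exact Finset.single_le_sum (f := fun g => f g * g.2) (fun _ _ => Nat.zero_le _) hg
      exact le_trans (Nat.le_mul_of_pos_right _ hgpos) h1
    let c : ↥Sp → Fin (k + 1) := fun g => ⟨f g, Nat.lt_succ_of_le (hbound g g.2)⟩
    have hcand : cand c = ∑ g ∈ Sp, f g • g := by
      show ∑ g : ↥Sp, (f g : ℕ) • (g : (Fin n → ℤ) × ℕ) = _
      exact Finset.sum_coe_sort Sp (fun g => f g • g)
    have hcand2 : (cand c).2 = k := by
      rw [hcand, Prod.snd_sum]; simpa using hdeg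
    set z : (Fin n → ℤ) × ℕ := ∑ g ∈ S.filter (fun g => ¬ 0 < g.2), f g • g with hz
    have hzmem : z ∈ secMonoid Δ m := AddSubmonoid.sum_mem _ fun g hg =>
      AddSubmonoid.nsmul_mem _ (hSsub _ (Finset.mem_filter.1 hg).1) _
    have hz2 : z.2 = 0 := by
      rw [hz, Prod.snd_sum]
      exact Finset.sum_eq_zero fun g hg => by
        have : g.2 = 0 := by have := (Finset.mem_filter.1 hg).2; omega
        simp [this]
    refine ⟨(cand c).1, Finset.mem_image.2 ⟨c, Finset.mem_filter.2 ⟨Finset.mem_univ _, hcand2⟩, rfl⟩,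
      z.1, ?_, ?_⟩
    · show (z.1, 0) ∈ secMonoid Δ m
      rw [← hz2]; exact hzmem
    · have h1 := congrArg Prod.fst hf
      rw [hsplit, Prod.fst_add, ← hcand] at h1
      exact h1.symm

end Literature.Geometry.PolyhedralFans
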